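import Mathlib.LinearAlgebra.Dual.Lemmas
import Literature.NumberTheory.Automorphic.AutomorphicForms
import Literature.NumberTheory.Automorphic.AutomorphicRepsGLSatakeFlathProofs
import Literature.NumberTheory.Automorphic.RealMatrixGroupsExpOpen
import HarnessLib

/-!
# Automorphic representations are `(𝔤, K_∞)`-modules — proof of
`AutomorphicRepData.isGKModule_of_hasLieAction`

Topic `NumberTheory/Automorphic`; sibling proof file of `AutomorphicForms` (everything here is
proved, no definitions). It discharges, sorry-free, the named fact
`AutomorphicRepData.isGKModule_of_hasLieAction π` of
`Literature/NumberTheory/Automorphic/AutomorphicForms.lean`: for an automorphy datum `𝒟` which is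
*regular* (`𝒟.IsRegular`: in particular `𝔤 = 𝒟.arch.lie` is the full Lie algebra of `G_∞`) over a
finite-dimensional coefficient algebra, and an automorphic representation `π = W / W'`
(`AutomorphicRepData 𝒟`: `W' < W` stable subspaces of the space of automorphic forms, `W / W'`
irreducible) with its `K_∞`-action `π.kRep` by right translation and a Lie algebra action `ρ𝔤`
which *is* the action of `π` (`π.HasLieAction ρ𝔤`: `ρ𝔤 X [φ] = [X φ]`, `X φ` the Lie derivative through
right translation), the pair `(π.kRep, ρ𝔤)` satisfies the four `(𝔤, K)`-module axioms `IsGKModule`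
of `GKModules` (Wallach, *Real Reductive Groups I*, §3.3.1; Borel–Wallach, Ch. 0, 2.5): every vector
is `K_∞`-finite, `K_∞` acts weakly continuously, `ρK k ∘ ρ𝔤 X ∘ ρK k⁻¹ = ρ𝔤 (Ad k X)`, and the weak
derivative of `ρK` along `X ∈ 𝔨` is `ρ𝔤 X`.

Source of the statement: Borel–Jacquet, *Automorphic forms and automorphic representations*
(Corvallis 1979), 4.6: an automorphic representation of `G(𝔸)` is an irreducible representation of
`(𝔤, K_∞) × G(𝔸_f)` isomorphic to a subquotient of the space `𝒜` of automorphic forms, where (4.3)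
`𝒜` is a `(𝔤, K_∞)`-module under right translation by `K_∞` and right-invariant differentiation by
`𝔤` (§1.3–1.5); that such a space of smooth `K`-finite functions with these two actions is a
`(𝔤, K)`-module in the axiomatic sense is Borel–Wallach, Ch. 0, 2.5–2.6, Wallach §3.3.1, and — for
automorphic forms on `GL_n` — Getz–Hahn, *An Introduction to Automorphic Representations* (2024),
§4.4 (Def. 4.4.4 of a `(𝔤, K)`-module; §6.3–6.5, automorphic forms form a `(𝔤, K_∞) × G(𝔸_f)`-module).

## The proof, axiom by axiom

Let `v = [φ] ∈ W / W'`, `φ ∈ W`, and let `ℓ` be a linear functional on `W / W'`.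

1. `kFinite`. `φ` lies in the span of automorphic forms, so it is `K_∞`-finite
   (`IsStableSubmodule.isKFinite`, tree): its right `K_∞`-translates span a finite-dimensional space
   `T ≤ W`, and the span of the `K_∞`-orbit of `v` is the image of (the copy in `W` of) `T` under
   `W → W / W'`.
2. `weaklyContinuous`. The functional `ψ ↦ ℓ [ψ]` on the finite-dimensional function space `T` is
   a finite linear combination of evaluations `ψ ↦ ψ (xᵢ)` (`exists_finsupp_sum_eval_eq`: the
   evaluation functionals span the dual of a finite-dimensional space of functions, as their common
   kernel is `0`), so `k ↦ ℓ (π.kRep k v) = ∑ cᵢ φ (xᵢ k)` and it suffices that `k ↦ φ (x k)` is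
   continuous on `K_∞`. This is where regularity enters: `y ↦ φ (x y)` is continuous on `G_∞`
   because all its exponential slices `X ↦ φ (x y₀ exp X)` are smooth (`IsArchSmooth`) and the
   exponential charts of a linear real group *with full Lie algebra* are open at `0`
   (`RealMatrixGroup.continuous_of_continuousAt_comp_expMem`, von Neumann–Cartan, file
   `RealMatrixGroupsExpOpen`). Without fullness of `𝔤` the statement is false.
3. `ad_compat`. On `[φ]` both sides are classes of functions, and
   `r(k) (X (r(k⁻¹) φ)) = (Ad k X) φ` (`archTranslate_lieDeriv`, tree: `exp (t Ad(k) X) k = k exp (tX)`).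
4. `hasWeakDeriv`. With `T' = T + ℂ · Xφ ≤ W` (finite-dimensional) and `ℓ ∘ [·]` on `T'` again a finite
   combination of evaluations, `t ↦ ℓ (π.kRep (exp tX) v) = ∑ cᵢ φ (xᵢ exp tX)` has derivative
   `∑ cᵢ (Xφ)(xᵢ) = ℓ (ρ𝔤 X v)` at `0`, since `t ↦ φ (x exp tX)` has derivative `(Xφ)(x)` at `0` for `φ`
   smooth in the archimedean variable (definition of the Lie derivative).

Only `IsRegular.mem_lie_of_expGL_mem` is used from regularity.

Design notes. The general archimedean-calculus lemmas `archTranslate_lieDeriv` (`Ad`-equivariance),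
`IsStableSubmodule.isArchSmooth`, `IsStableSubmodule.isKFinite` and
`archTranslate_mem_kTranslateSpan` live in `AutomorphicRepsGLSatakeFlathProofs` (§4 there), which is
therefore imported rather than copied; the `s = 0` case of `IsArchSmooth.hasDerivAt_expMem_smul`
(`AutomorphicFormsL2Derivative`, a much heavier import) is re-proved privately. (H1)
`attribute [local instance 100] LieRing.ofAssociativeRing` as in all files of this topic.

## Main results

* `Literature.NumberTheory.Automorphic.span_eval_comp_subtype_eq_top`,
  `Literature.NumberTheory.Automorphic.exists_finsupp_sum_eval_eq` — evaluations span the dual of a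
  finite-dimensional function space (proved).
* `Literature.NumberTheory.Automorphic.IsArchSmooth.continuous_comp_mul`,
  `Literature.NumberTheory.Automorphic.IsArchSmooth.continuous_comp_mul_inclusion` — continuity of
  `y ↦ φ (x ι(y))` on a linear real group with full Lie algebra (resp. on its `K`) for `φ` smooth in
  the archimedean variable (proved).
* `Literature.NumberTheory.Automorphic.AutomorphicRepData.exists_finsupp_dual_mkQ_eq` — a functional
  on `W / W'` is a finite combination of point evaluations on every finite-dimensional `T ≤ W` (proved).
* `Literature.NumberTheory.Automorphic.AutomorphicRepData.isGKModule_of_hasLieAction_holds` (proved):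
  the named fact `AutomorphicRepData.isGKModule_of_hasLieAction π` holds.

## References

* A. Borel, H. Jacquet, *Automorphic forms and automorphic representations*, Proc. Sympos. Pure
  Math. 33 (1979), part 1, 189–202, §1.3–1.5, 4.3, 4.6 [BorelJacquet1979].
* N. R. Wallach, *Real Reductive Groups I*, Academic Press 1988, §3.3.1 [WallachRRG1].
* A. Borel, N. Wallach, *Continuous Cohomology, Discrete Subgroups, and Representations of Reductive
  Groups*, 2nd ed., AMS 2000, Ch. 0, 2.5–2.6 [BorelWallach2000].
* J. R. Getz, H. Hahn, *An Introduction to Automorphic Representations*, GTM 300, Springer 2024,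
  §4.4 and §6.3–6.5 [GetzHahn2024].
* B. C. Hall, *Lie Groups, Lie Algebras, and Representations*, 2nd ed. 2015, Thm. 3.42, Cor. 3.44
  [Hall2015].
-/

-- Mathlib idiom (Mathlib/Algebra/Lie/OfAssociative.lean); needed to mention Lie subalgebras of matrix algebras
attribute [local instance 100] LieRing.ofAssociativeRing

open scoped MatrixGroups Matrix ContDiff Topology
open Filter

noncomputable section

namespace Literature.NumberTheory.Automorphic

/-! ### 1. Functionals on a finite-dimensional function space are combinations of evaluations -/

section Eval

variable {𝕜 : Type*} [Field 𝕜] {X : Type*}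

/-- **The evaluation functionals span the dual of a finite-dimensional function space.** For a
finite-dimensional subspace `S` of the functions `X → 𝕜`, the restrictions to `S` of the
evaluations `f ↦ f x`, `x ∈ X`, span `Dual S`: their common kernel (the dual coannihilator of their
span) is `0`, and in finite dimension a subspace of the dual is the annihilator of its coannihilator.
(Linear algebra; e.g. the duality `W = W⁰⁰` of Halmos, *Finite-Dimensional Vector Spaces*, §17.) [folklore] -/
theorem span_eval_comp_subtype_eq_top (S : Submodule 𝕜 (X → 𝕜)) [FiniteDimensional 𝕜 S] :
    Submodule.span 𝕜 (Set.range fun x : X ↦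
      (LinearMap.proj x : (X → 𝕜) →ₗ[𝕜] 𝕜).comp S.subtype) = ⊤ := by
  set Φ : Submodule 𝕜 (Module.Dual 𝕜 S) := Submodule.span 𝕜 (Set.range fun x : X ↦
    (LinearMap.proj x : (X → 𝕜) →ₗ[𝕜] 𝕜).comp S.subtype) with hΦ_def
  have h0 : Φ.dualCoannihilator = ⊥ := by
    rw [eq_bot_iff]
    intro f hf
    rw [Submodule.mem_dualCoannihilator] at hf
    rw [Submodule.mem_bot]
    refine Subtype.ext (funext fun x ↦ ?_)
    exact hf _ (Submodule.subset_span ⟨x, rfl⟩)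
  rw [← Subspace.dualCoannihilator_dualAnnihilator_eq (W := Φ), h0, Submodule.dualAnnihilator_bot]

/-- Every linear functional on a finite-dimensional space `S` of functions `X → 𝕜` is a finite
linear combination of evaluations: `L f = ∑ₓ c x · f x` for a finitely supported `c`.
(Consequence of `span_eval_comp_subtype_eq_top`.) [folklore] -/
theorem exists_finsupp_sum_eval_eq (S : Submodule 𝕜 (X → 𝕜)) [FiniteDimensional 𝕜 S]
    (L : S →ₗ[𝕜] 𝕜) :
    ∃ c : X →₀ 𝕜, ∀ f : S, (c.sum fun x a ↦ a * (f : X → 𝕜) x) = L f := by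
  have hL : L ∈ Submodule.span 𝕜 (Set.range fun x : X ↦
      (LinearMap.proj x : (X → 𝕜) →ₗ[𝕜] 𝕜).comp S.subtype) := by
    rw [span_eval_comp_subtype_eq_top]
    exact Submodule.mem_top
  obtain ⟨c, hc⟩ := Finsupp.mem_span_range_iff_exists_finsupp.mp hL
  refine ⟨c, fun f ↦ ?_⟩
  rw [← hc]
  simp [Finsupp.sum, LinearMap.sum_apply]

end Eval

/-! ### 2. Continuity of archimedean translates of archimedean-smooth functions -/

section ArchContinuity

variable {A : Type*} [NormedCommRing A] [NormedAlgebra ℝ A] [NormedAlgebra ℚ A] [CompleteSpace A]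
  [StarRing A] {N : Type*} [Fintype N] [DecidableEq N] {H : RealMatrixGroup A N}
  {G : Type*} [Group G] (ι : H.carrier →* G)

open scoped Matrix.Norms.Operator in
/-- **The curve `t ↦ φ (g exp tX)` has derivative `(X φ)(g)` at `t = 0`** for `φ` smooth in the
archimedean variable (the derivative exists since `Y ↦ φ (g exp Y)` is smooth on `𝔤`, composed with
the line `t ↦ tX`; its value is the Lie derivative by definition). A private copy of the `s = 0`
case of `IsArchSmooth.hasDerivAt_expMem_smul` of `AutomorphicFormsL2Derivative` (not imported, to
keep this file light). Borel–Jacquet 1979, §1.5. [cite: BorelJacquet1979, §1.5] -/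
private theorem IsArchSmooth.hasDerivAt_expMem_smul_zero {φ : G → ℂ} (hφ : IsArchSmooth ι φ)
    (X : H.lie) (g : G) :
    HasDerivAt (fun t : ℝ ↦ φ (g * ι (H.expMem (t • X)))) (lieDeriv ι X φ g) 0 := by
  set v : H.lie.toSubmodule := ⟨X, X.2⟩ with hv
  have hd : DifferentiableAt ℝ (fun t : ℝ ↦ φ (g * ι (H.expMem (t • X)))) 0 := by
    have hF : DifferentiableAt ℝ (fun Y : H.lie.toSubmodule ↦ φ (g * ι (H.expMem ⟨Y, Y.2⟩)))
        ((fun t : ℝ ↦ t • v) 0) := by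
      have h0 : (fun t : ℝ ↦ t • v) 0 = 0 := zero_smul _ _
      rw [h0]
      exact ((hφ g).differentiable (by simp)).differentiableAt
    have hL : DifferentiableAt ℝ (fun t : ℝ ↦ t • v) 0 := differentiableAt_id.smul_const _
    have hcomp : DifferentiableAt ℝ
        ((fun Y : H.lie.toSubmodule ↦ φ (g * ι (H.expMem ⟨Y, Y.2⟩))) ∘ fun t : ℝ ↦ t • v) 0 :=
      hF.comp 0 hL
    exact hcomp
  exact hd.hasDerivAt

-- the scoped operator norm on `𝔤` is the one through which `IsArchSmooth` is defined; its topology on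
-- `𝔤 ≤ 𝔤𝔩(N, A)` is only reducibly defeq to the subspace topology, whence the `isDefEq` setting
set_option backward.isDefEq.respectTransparency false in
open scoped Matrix.Norms.Operator in
/-- **Archimedean translates of archimedean-smooth functions are continuous** on a linear real group
with *full* Lie algebra over a finite-dimensional coefficient algebra: for `φ` smooth in the
archimedean variable, `y ↦ φ (g ι(y))` is continuous on `H`, because its exponential slices
`X ↦ φ (g ι(y₀) ι(exp X))` through every `y₀` are smooth, hence continuous, and the exponential charts
`X ↦ y₀ exp X` are open at `0` (`RealMatrixGroup.continuous_of_continuousAt_comp_expMem`,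
von Neumann–Cartan). Borel–Jacquet 1979, §1.1 and 4.1 (automorphic forms are smooth, in particular
continuous, in the archimedean variable); Hall 2015, Cor. 3.44. [cite: BorelJacquet1979, §1.1 and 4.1] -/
theorem IsArchSmooth.continuous_comp_mul [FiniteDimensional ℝ A]
    (hreg : ∀ X : Matrix N N A, (∀ t : ℝ, expGL (t • X) ∈ H.carrier) → X ∈ H.lie)
    {φ : G → ℂ} (hφ : IsArchSmooth ι φ) (g : G) :
    Continuous fun y : H.carrier ↦ φ (g * ι y) := by
  refine H.continuous_of_continuousAt_comp_expMem hreg fun y₀ ↦ ?_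
  have h := (hφ (g * ι y₀)).continuous.continuousAt (x := (0 : H.lie.toSubmodule))
  simp only [map_mul, mul_assoc] at h ⊢
  exact h

/-- Continuity of `k ↦ φ (g ι(k))` on `K = H.maximalCompact`, for `φ` smooth in the archimedean
variable and `H` with full Lie algebra (`IsArchSmooth.continuous_comp_mul` restricted to `K`).
Borel–Jacquet 1979, §1.1 and 4.1. [cite: BorelJacquet1979, §1.1 and 4.1] -/
theorem IsArchSmooth.continuous_comp_mul_inclusion [FiniteDimensional ℝ A]
    (hreg : ∀ X : Matrix N N A, (∀ t : ℝ, expGL (t • X) ∈ H.carrier) → X ∈ H.lie)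
    {φ : G → ℂ} (hφ : IsArchSmooth ι φ) (g : G) :
    Continuous fun k : H.maximalCompact ↦
      φ (g * ι (Subgroup.inclusion H.maximalCompact_le_carrier k)) := by
  have hincl : Continuous
      (Subgroup.inclusion H.maximalCompact_le_carrier : H.maximalCompact → H.carrier) :=
    Topology.IsInducing.subtypeVal.continuous_iff.2
      (by simpa only [Function.comp_def, Subgroup.coe_inclusion] using continuous_subtype_val)
  exact (hφ.continuous_comp_mul ι hreg g).comp hincl

end ArchContinuity

/-! ### 3. The `(𝔤, K_∞)`-module of an automorphic representation -/

section GKModule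

variable {K : Type} [Field K] [NumberField K]
  {A : Type*} [NormedCommRing A] [NormedAlgebra ℝ A] [NormedAlgebra ℚ A] [CompleteSpace A]
  [StarRing A] {N : Type*} [Fintype N] [DecidableEq N]
  {𝒢 : AdelicGroupData K} {𝒟 : AutomorphyDatum 𝒢 A N} (π : AutomorphicRepData 𝒟)

namespace AutomorphicRepData

/-- The right `K_∞`-translate `r(k) φ ∈ W` of `φ ∈ W`, as an element of `W`.
Borel–Jacquet 1979, 4.3 and 4.6. [cite: BorelJacquet1979, 4.6] -/
theorem rightTranslation_ofK_mem (k : 𝒟.arch.maximalCompact) (φ : π.W) :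
    rightTranslation 𝒢 (𝒟.ofK k) φ ∈ π.W :=
  π.stable.k_stable k φ.2

/-- `π.kRep k [φ] = [r(k) φ]` with `[·] = π.mkQ`. Borel–Jacquet 1979, 4.6. [cite: BorelJacquet1979, 4.6] -/
theorem kRep_mkQ (k : 𝒟.arch.maximalCompact) (φ : π.W) :
    π.kRep k (π.mkQ φ) =
      π.mkQ ⟨rightTranslation 𝒢 (𝒟.ofK k) φ, π.rightTranslation_ofK_mem k φ⟩ :=
  rfl

/-- **A linear functional on `W / W'` evaluated along `W` is a finite combination of point
evaluations on any finite-dimensional space of functions `T ≤ W`**: for `ℓ ∈ (W/W')^*` there is a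
finitely supported `c` with `ℓ [ψ] = ∑ₓ c x · ψ x` for all `ψ ∈ T`
(`exists_finsupp_sum_eval_eq` applied to `ℓ ∘ [·] ∘ (T ↪ W)`). [folklore] -/
theorem exists_finsupp_dual_mkQ_eq (ℓ : Module.Dual ℂ π.Quot) {T : Submodule ℂ (𝒢.Adelic → ℂ)}
    [FiniteDimensional ℂ T] (hTW : T ≤ π.W) :
    ∃ c : 𝒢.Adelic →₀ ℂ, ∀ (ψ : 𝒢.Adelic → ℂ) (hψ : ψ ∈ T),
      (c.sum fun x a ↦ a * ψ x) = ℓ (π.mkQ ⟨ψ, hTW hψ⟩) := by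
  obtain ⟨c, hc⟩ :=
    exists_finsupp_sum_eval_eq T (ℓ ∘ₗ π.mkQ ∘ₗ Submodule.inclusion hTW)
  exact ⟨c, fun ψ hψ ↦ hc ⟨ψ, hψ⟩⟩

/-- **Automorphic representations are `(𝔤, K_∞)`-modules** (discharge of the named fact
`AutomorphicRepData.isGKModule_of_hasLieAction`). For a regular automorphy datum over a
finite-dimensional coefficient algebra and an automorphic representation `π = W / W'` with its
`K_∞`-action `π.kRep` and its Lie algebra action `ρ𝔤` (`π.HasLieAction ρ𝔤`), the pair
`(π.kRep, ρ𝔤)` is a `(𝔤, K_∞)`-module (`IsGKModule`): (1) every `[φ]` is `K_∞`-finite since `φ` is;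
(2) `k ↦ ℓ (π.kRep k [φ]) = ∑ cᵢ φ (xᵢ k)` is continuous, `k ↦ φ (x k)` being continuous because the
exponential slices of `φ` are smooth and the exponential charts of `G_∞` (full Lie algebra) are open at
`0` (von Neumann–Cartan); (3) `r(k) X r(k⁻¹) = Ad(k) X` on functions; (4)
`d/dt ℓ (π.kRep (exp tX) [φ])|₀ = ∑ cᵢ (Xφ)(xᵢ) = ℓ (ρ𝔤 X [φ])`. See the module docstring.
Borel–Jacquet 1979, 4.6 with 4.3 and §1.3–1.5 (automorphic representations are representations of
`(𝔤, K_∞) × G(𝔸_f)` on subquotients of `𝒜`); the `(𝔤, K)`-module axioms: Wallach, §3.3.1;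
Borel–Wallach, Ch. 0, 2.5–2.6; Getz–Hahn 2024, Def. 4.4.4 and §6.3–6.5.
[cite: BorelJacquet1979, 4.6 with 4.3 and §1.3–1.5] [cite: WallachRRG1, §3.3.1]
[cite: BorelWallach2000, Ch. 0 §2.5–2.6] -/
theorem isGKModule_of_hasLieAction_holds : π.isGKModule_of_hasLieAction := by
  intro _ _ _ h𝒟 ρ𝔤 hρ
  have hreg := h𝒟.mem_lie_of_expGL_mem
  -- every vector of `W / W'` is a class `[φ]`, `φ ∈ W`
  have hsurj : ∀ v : π.Quot, ∃ φ : π.W, π.mkQ φ = v := π.kerQuot.mkQ_surjective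
  -- smoothness and `K_∞`-finiteness of the elements of `W`
  have hsmooth : ∀ φ : π.W, IsArchSmooth 𝒟.ofArch (φ : 𝒢.Adelic → ℂ) :=
    fun φ ↦ π.stable.isArchSmooth φ.2
  -- the finite-dimensional translate span `T φ ≤ W` and its copy `TW φ ≤ W`
  have hTW : ∀ φ : π.W, kTranslateSpan 𝒟.ofArch (φ : 𝒢.Adelic → ℂ) ≤ π.W := fun φ ↦
    Submodule.span_le.2 (by
      rintro _ ⟨k, rfl⟩
      exact π.stable.k_stable k φ.2)
  have hTfin : ∀ φ : π.W, FiniteDimensional ℂ (kTranslateSpan 𝒟.ofArch (φ : 𝒢.Adelic → ℂ)) :=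
    fun φ ↦ π.stable.isKFinite φ.2
  have hmemT : ∀ (φ : π.W) (k : 𝒟.arch.maximalCompact),
      rightTranslation 𝒢 (𝒟.ofK k) φ ∈ kTranslateSpan 𝒟.ofArch (φ : 𝒢.Adelic → ℂ) :=
    fun φ k ↦ archTranslate_mem_kTranslateSpan 𝒟.ofArch k (φ : 𝒢.Adelic → ℂ)
  -- (1) `K_∞`-finiteness
  have kfin : ∀ v : π.Quot, FiniteDimensional ℂ
      (Submodule.span ℂ (Set.range fun k : 𝒟.arch.maximalCompact ↦ π.kRep k v)) := by
    intro v
    obtain ⟨φ, rfl⟩ := hsurj v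
    haveI := hTfin φ
    -- the copy of `T φ` inside `W`
    let TW : Submodule ℂ π.W := (kTranslateSpan 𝒟.ofArch (φ : 𝒢.Adelic → ℂ)).comap π.W.subtype
    haveI hTWfin : FiniteDimensional ℂ TW := by
      have hle : TW.map π.W.subtype ≤ kTranslateSpan 𝒟.ofArch (φ : 𝒢.Adelic → ℂ) :=
        Submodule.map_comap_le _ _
      haveI := Submodule.finiteDimensional_of_le hle
      exact (Submodule.equivMapOfInjective π.W.subtype π.W.injective_subtype TW).symm.finiteDimensional
    refine Submodule.finiteDimensional_of_le (S₂ := TW.map π.mkQ) (Submodule.span_le.2 ?_)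
    rintro _ ⟨k, rfl⟩
    exact ⟨⟨rightTranslation 𝒢 (𝒟.ofK k) φ, π.rightTranslation_ofK_mem k φ⟩, hmemT φ k, rfl⟩
  refine ⟨kfin, ?_, ?_, ?_⟩
  · -- (2) weak continuity of the `K_∞`-action
    intro v ℓ
    obtain ⟨φ, rfl⟩ := hsurj v
    haveI := hTfin φ
    obtain ⟨c, hc⟩ := π.exists_finsupp_dual_mkQ_eq ℓ (hTW φ)
    have key : (fun k : 𝒟.arch.maximalCompact ↦ ℓ (π.kRep k (π.mkQ φ))) =
        fun k ↦ c.sum fun x a ↦ a * (φ : 𝒢.Adelic → ℂ) (x * 𝒟.ofK k) := by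
      funext k
      rw [kRep_mkQ, ← hc _ (hmemT φ k)]
      rfl
    rw [key]
    refine continuous_finsetSum _ fun x _ ↦ continuous_const.mul ?_
    exact (hsmooth φ).continuous_comp_mul_inclusion 𝒟.ofArch hreg (x : 𝒢.Adelic)
  · -- (3) compatibility with `Ad`
    intro k X
    refine Submodule.linearMap_qext _ (LinearMap.ext fun φ ↦ ?_)
    change π.kRep k (ρ𝔤 X (π.kRep k⁻¹ (π.mkQ φ))) =
      ρ𝔤 (𝒟.arch.Ad (Subgroup.inclusion 𝒟.arch.maximalCompact_le_carrier k) X) (π.mkQ φ)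
    rw [kRep_mkQ, hρ, hρ, kRep_mkQ]
    congr 1
    refine Subtype.ext ?_
    change rightTranslation 𝒢 (𝒟.ofK k)
        (lieDeriv 𝒟.ofArch X (rightTranslation 𝒢 (𝒟.ofK k⁻¹) (φ : 𝒢.Adelic → ℂ))) =
      lieDeriv 𝒟.ofArch (𝒟.arch.Ad (Subgroup.inclusion 𝒟.arch.maximalCompact_le_carrier k) X)
        (φ : 𝒢.Adelic → ℂ)
    rw [← 𝒟.archTranslate_ofK, ← 𝒟.archTranslate_ofK, archTranslate_lieDeriv, map_inv,
      ← Module.End.mul_apply, ← map_mul, mul_inv_cancel, map_one, Module.End.one_apply]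
  · -- (4) the weak derivative of `ρK` along `𝔨`
    intro X v ℓ
    obtain ⟨φ, rfl⟩ := hsurj v
    haveI := hTfin φ
    set Y : 𝒟.arch.lie := LieSubalgebra.inclusion 𝒟.arch.compactLie_le_lie X with hY
    -- the finite-dimensional space `T' = T + ℂ Xφ ≤ W`
    set T' : Submodule ℂ (𝒢.Adelic → ℂ) :=
      kTranslateSpan 𝒟.ofArch (φ : 𝒢.Adelic → ℂ) ⊔ ℂ ∙ lieDeriv 𝒟.ofArch Y (φ : 𝒢.Adelic → ℂ)
      with hT'
    haveI : FiniteDimensional ℂ T' := Submodule.finiteDimensional_sup _ _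
    have hT'W : T' ≤ π.W :=
      sup_le (hTW φ) ((Submodule.span_singleton_le_iff_mem _ _).2 (π.stable.lie_stable Y _ φ.2))
    obtain ⟨c, hc⟩ := π.exists_finsupp_dual_mkQ_eq ℓ hT'W
    have hexp : ∀ t : ℝ, 𝒟.ofK (𝒟.arch.expK (t • X)) = 𝒟.ofArch (𝒟.arch.expMem (t • Y)) := by
      intro t
      rfl
    -- the function and the value of the derivative, as finite sums of slices
    have key : (fun t : ℝ ↦ ℓ (π.kRep (𝒟.arch.expK (t • X)) (π.mkQ φ))) =
        fun t ↦ c.sum fun x a ↦ a * (φ : 𝒢.Adelic → ℂ) (x * 𝒟.ofArch (𝒟.arch.expMem (t • Y))) := by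
      funext t
      rw [kRep_mkQ, ← hc _ (Submodule.mem_sup_left (hmemT φ _)), hexp]
      rfl
    have key' : ℓ (ρ𝔤 Y (π.mkQ φ)) =
        c.sum fun x a ↦ a * lieDeriv 𝒟.ofArch Y (φ : 𝒢.Adelic → ℂ) x := by
      rw [hρ]
      exact (hc _ (Submodule.mem_sup_right (Submodule.mem_span_singleton_self _))).symm
    rw [key, key']
    refine HasDerivAt.fun_sum fun x _ ↦ ?_
    exact ((hsmooth φ).hasDerivAt_expMem_smul_zero 𝒟.ofArch Y (x : 𝒢.Adelic)).const_mul _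

end AutomorphicRepData

end GKModule

end Literature.NumberTheory.Automorphic
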